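import Literature.AnabelianGeometry.EtaleTheta.LogDivisorModelZTowerRays
import Literature.AnabelianGeometry.EtaleTheta.TemperedFrobenioidOfDiagonalBase
import Literature.AnabelianGeometry.EtaleTheta.TemperedFrobenioidOfKummerTateTower
import Literature.AnabelianGeometry.EtaleTheta.DivisorMonoidsOfGaloisCoveringTempered
import Literature.AlgebraicGeometry.Frobenioids.QuasiTemperoidConnectedPart
import HarnessLib

/-!
# [EtTh] Def. 3.6 (ii) / Def. 4.1 (ii) / Prop. 4.2 (iii) at the Kummer–Tate tower (v2 model of record): the DIAGONAL-BASE
# tempered Frobenioid over the FULL base `B^temp(Grp)⁰` (identity base functor) — rank `[ℤ : γ(H)]`, `Φ^{bs-fld}` PROPER — and the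
# A10 / condition-(d) knit WITHOUT the E2 hypothesis there (class (b) NV)

S. Mochizuki, *The étale theta function …*, Publ. RIMS **45** (2009) [MochizukiEtTh2009], Def. 3.3 (iii) / Rmk. 3.3.1 p.73, Def. 3.6
(ii) p.76–77, Def. 4.1 (i)(ii) p.86, Prop. 4.2 (iii) p.89 [cite: MochizukiEtTh2009, Def 3.6 p.77]; [FrdI] Thm. 5.2 (ii) p.100.

abc-iut cell, layer L2 [EtTh], seat abc-iut-w5-d179 (gen 6), L2-lead row R606 «DIAGONAL-BASE TF AT THE KUMMER–TATE TOWER + R566 (2)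
KNIT THERE» (abc-iut-L2-t3's gated row (2) withdrawn in its favour, 2026-08-26T20:01Z).  INPUTS BY NAME: abc-iut-w6-d058's
Kummer–Tate tower `TateTowerKummer.tower` (p457919: every level the Tate skeleton, `Grp = ℤ_γ × ℤ^ℕ` acting through the
translation character `γ = fst` — so `TateTowerKummer.act = ZTower.action γ` DEFINITIONALLY), abc-iut-L2-t3's v2 datum
`DivisorMonoids.ofTower` (`Φ₀(Y) = Hom_Grp(Y, Div⁺(Z_∞^{(lvl Y)}))`, transitions = pull-back then `(·)^{e}`, `e` the ramification
index), `TateTowerKummer.hpf`, `TateTowerKummer.baseRootLaw_top_of_full_essSurj` / `condD_mkOfModelCanonical_of_full_essSurj`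
(w6-d058, no-`hR` forms at the tower where `RootLaw` is a theorem), this seat's `ZTower.*` (p460567), rays (`LogDivisorModelZTowerRays`)
and engine `TemperedFrobenioid.ofDiagonalBase` (p462730).  abc-iut-L2-d2's `TateTowerKummer.temperedFrobenioid` (p465xxx) is the
RANK-ONE tf over the ONE-POINT covering of this tower (constant base functor); THIS FILE is the higher-rank tf over the WHOLE base:
* §0 `ZTower` divisibility through coordinates: `dvd_iff_toAdd_coord_le`, `pow_dvd_pow_iff`, `pow_left_injective`, `ray_pow_ne_diag_pow`;
* `TateTowerKummer.Φ₀_map_hom_eq` — the v2 transition of `Φ₀` at the tower is `ψ ↦ (Φ₀-pull-back ψ)^e`; hence injective and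
  divisibility-reflecting (`Φ₀_map_injective`, `Φ₀_map_reflects_dvd`);
* **`TateTowerKummer.diagonalBase`** (`F := 𝟭`, coordinates `ZTower.coord γ`, diagonal `ZTower.diag γ`) and
  **`TateTowerKummer.diagTemperedFrobenioid R S`** — Def. 3.6 (ii) over `ofRlfZWeak (ofTower tower) hpf` with IDENTITY base functor
  (full, essentially surjective), every clause proved; `Φ^{bs-fld}(Y) = ι(⟨diag⟩^pf)` (`diagTemperedFrobenioid_bsFld_carrier`) and
  **PROPER at `Grp/Δ₀`** (`exists_mem_Φ_not_mem_bsFld_quotZero`: over the covering `Grp/Δ₀ ≅ ℤ_γ` the ray of `(s₀, F_0)` is a single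
  component, not a root of a power of the special fibre); it IS a Frobenioid;
* **R566 (2) KNIT**: `diag_baseRootLaw_top` — A10 `BaseRootLaw ⊤` for THIS tf with NO E2 hypothesis (w6-d058's no-`hR` theorem fires:
  base = `𝟭` is full and essentially surjective) — and `diag_condD_mkOfModelCanonical` — condition (d) at every object of the canonical
  §4 model over this tf, the standing §4-model binders (`gS`, `NH`, `A₀`, `hΦd`, `hTF`) untouched, `hR` GONE.
Class (b): 2 defs (`diagonalBase`, `diagTemperedFrobenioid`) + 2 abbrevs (`γ`, `quotZero`); no Prop fact, no instance, no sorry.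
HONEST FRAMING: instantiation at a combinatorial consistency witness (NOT the formal-scheme tower of a Tate curve); nothing here
bears on [IUTchIII] Cor. 3.12; no side taken; typed ≠ proved.
-/

noncomputable section

namespace Literature.AnabelianGeometry.EtaleTheta

open CategoryTheory Opposite Function Literature.AlgebraicGeometry.Frobenioids Literature.AnabelianGeometry.SemiGraphs
  LogDivisorModel LogDivisorModel.GaloisAction LogDivisorTower

/-! ## §0 Divisibility in `Φ₀(S)` of the ℤ-tower through the coordinates -/

namespace LogDivisorModel.ZTower

open TateTower

variable {Γ : Type} [Group Γ] (φ : Γ →* Multiplicative ℤ) (S : Action (Type 0) Γ)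

/-- Multiplicities of a quotient. [cite: MochizukiEtTh2009, Def 3.1 p.70] -/
theorem mlt_div (a b : model.DIV) (x : TateTower.Idx) : mlt (a / b) x = mlt a x - mlt b x := rfl

/-- Divisibility forces coordinatewise `≤`. [cite: MochizukiEtTh2009, Def 3.1 p.70] -/
theorem toAdd_coord_le_of_dvd {ψ ψ' : (action φ).phiZero S} (h : ψ ∣ ψ') (s : S.V) (n : ℤ) :
    Multiplicative.toAdd (coord φ S s n ψ) ≤ Multiplicative.toAdd (coord φ S s n ψ') := by
  obtain ⟨c, rfl⟩ := h
  rw [map_mul, toAdd_mul]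
  exact Nat.le_add_right _ _

/-- **Coordinatewise `≤` gives divisibility** (the quotient, formed in `DIV(Z_∞)`, is effective and equivariant).
[cite: MochizukiEtTh2009, Def 3.3 p.73] -/
theorem dvd_of_toAdd_coord_le {ψ ψ' : (action φ).phiZero S}
    (h : ∀ (s : S.V) (n : ℤ), Multiplicative.toAdd (coord φ S s n ψ) ≤ Multiplicative.toAdd (coord φ S s n ψ')) : ψ ∣ ψ' := by
  refine ⟨⟨fun s => ψ'.1 s / ψ.1 s, fun s => mem_Divplus_of_nonneg fun x => ?_, fun g s => ?_⟩,
    Subtype.ext (funext fun s => ext_mlt fun x => ?_)⟩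
  · rcases x with c | n
    · exact c.elim
    · have h1 := Int.ofNat_le.mpr (h s n)
      rw [coord_natCast, coord_natCast] at h1
      show 0 ≤ mlt (ψ'.1 s / ψ.1 s) (Sum.inr n)
      rw [mlt_div]
      exact sub_nonneg.mpr h1
  · show ψ'.1 (S.ρ g s) / ψ.1 (S.ρ g s) = (action φ).actDIV g (ψ'.1 s / ψ.1 s)
    rw [ψ'.2.2 g s, ψ.2.2 g s, map_div]
  · show mlt (ψ'.1 s) x = mlt (ψ.1 s * (ψ'.1 s / ψ.1 s)) x
    rw [mlt_mul, mlt_div, add_sub_cancel]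

/-- `ψ ∣ ψ'` iff coordinatewise `≤`. [cite: MochizukiEtTh2009, Def 3.3 p.73] -/
theorem dvd_iff_toAdd_coord_le (ψ ψ' : (action φ).phiZero S) :
    ψ ∣ ψ' ↔ ∀ (s : S.V) (n : ℤ), Multiplicative.toAdd (coord φ S s n ψ) ≤ Multiplicative.toAdd (coord φ S s n ψ') :=
  ⟨fun h s n => toAdd_coord_le_of_dvd φ S h s n, dvd_of_toAdd_coord_le φ S⟩

/-- **Positive powers reflect divisibility** in `Φ₀(S)`. [cite: MochizukiEtTh2009, Def 3.3 p.73] -/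
theorem pow_dvd_pow_iff {ψ ψ' : (action φ).phiZero S} {k : ℕ} (hk : 0 < k) : ψ ^ k ∣ ψ' ^ k ↔ ψ ∣ ψ' := by
  rw [dvd_iff_toAdd_coord_le, dvd_iff_toAdd_coord_le]
  refine forall_congr' fun s => forall_congr' fun n => ?_
  rw [coord_pow, coord_pow, toAdd_ofAdd, toAdd_ofAdd]
  exact ⟨fun h => Nat.le_of_mul_le_mul_left h hk, fun h => Nat.mul_le_mul_left k h⟩

/-- **Positive powers are injective** on `Φ₀(S)`. [cite: MochizukiEtTh2009, Def 3.3 p.73] -/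
theorem pow_left_injective {k : ℕ} (hk : 0 < k) : Injective fun ψ : (action φ).phiZero S => ψ ^ k := fun ψ ψ' h =>
  coord_separating φ S fun s n => by
    have h1 : coord φ S s n (ψ ^ k) = coord φ S s n (ψ' ^ k) := congrArg (fun χ => coord φ S s n χ) h
    rw [coord_pow, coord_pow] at h1
    exact Multiplicative.toAdd.injective (Nat.eq_of_mul_eq_mul_left hk (Multiplicative.ofAdd.injective h1))

/-- **No positive power of a ray is a power of the diagonal as soon as some prime log-divisor lies OFF its orbit**: `Φ₀(S)` has rank
`> 1` there. [cite: MochizukiEtTh2009, Rmk 3.3.1 p.73] -/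
theorem ray_pow_ne_diag_pow (s₀ : S.V) {s : S.V} {n : ℤ} (hsn : ¬ InRay φ S s₀ s n) {a : ℕ} (ha : a ≠ 0) (c : ℕ) :
    ray φ S s₀ ^ a ≠ diag φ S ^ c := fun h => by
  have h1 : coord φ S s n (ray φ S s₀ ^ a) = coord φ S s n (diag φ S ^ c) := congrArg (fun ψ => coord φ S s n ψ) h
  rw [coord_diag_pow, map_pow, coord_ray_of_not_inRay φ S hsn, one_pow] at h1
  have hc : c = 0 := ofAdd_eq_one.mp h1.symm
  have h0 : coord φ S s₀ 0 (ray φ S s₀ ^ a) = coord φ S s₀ 0 (diag φ S ^ c) := congrArg (fun ψ => coord φ S s₀ 0 ψ) h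
  rw [coord_diag_pow, map_pow, coord_ray_of_inRay φ S (inRay_self φ S s₀), hc, ← ofAdd_nsmul, smul_eq_mul, mul_one] at h0
  exact ha (Multiplicative.ofAdd.injective h0)

end LogDivisorModel.ZTower

/-! ## §1 The Kummer–Tate tower: `Φ₀`-transitions, diagonal base data over the whole of `B^temp(Grp)⁰`, the tempered Frobenioid -/

namespace TateTowerKummer

/-- The translation character `γ : Grp = ℤ_γ × ℤ^ℕ → ℤ`. [cite: MochizukiEtTh2009, Def 3.3 (iii) p.73] -/
abbrev γ : Grp →* Multiplicative ℤ := MonoidHom.fst (Multiplicative ℤ) (ℕ → Multiplicative ℤ)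

/-- The tower's action IS the ℤ-tower action of `γ` (definitionally). [cite: MochizukiEtTh2009, Def 3.3 (iii) p.73] -/
theorem act_eq_action : act = ZTower.action γ := rfl

/-- Every connected tempered `Grp`-covering is one orbit. [cite: MochizukiFrdII2008, Ex 1.3 (ii) p.11] -/
theorem isConnectedGSet_gset (A : ConnectedPart (BTemp Grp)) : isConnectedGSet (gset A) := isConnectedGSet_temperedInclusion A

/-- **The v2 transition of `Φ₀` at the tower**: pull back along the covering map, then raise to the ramification index.
[cite: MochizukiEtTh2009, Def 3.3 (iii) p.74] -/
theorem Φ₀_map_hom_eq {Y Y' : (ConnectedPart (BTemp Grp))ᵒᵖ} (f : Y ⟶ Y') (ψ : (DivisorMonoids.ofTower tower).Φ₀.obj Y) :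
    ((DivisorMonoids.ofTower tower).Φ₀.map f).hom ψ =
      (ZTower.action γ).phiZeroPull f.unop.hom.hom ψ ^ e (levels.lvl Y.unop) (levels.lvl Y'.unop) :=
  Subtype.ext (funext fun _ => rfl)

/-- The ramification index along a covering map is positive. [cite: MochizukiEtTh2009, Def 3.3 (ii) p.73] -/
theorem e_lvl_pos {Y Y' : (ConnectedPart (BTemp Grp))ᵒᵖ} (f : Y ⟶ Y') : 0 < e (levels.lvl Y.unop) (levels.lvl Y'.unop) :=
  e_pos (le_of_closure_le (levels.closure_lvl_mono f.unop))

/-- **The transitions of `Φ₀` at the tower are injective.** [cite: MochizukiEtTh2009, Def 3.3 (iii) p.74] -/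
theorem Φ₀_map_injective {Y Y' : (ConnectedPart (BTemp Grp))ᵒᵖ} (f : Y ⟶ Y') :
    Injective ((DivisorMonoids.ofTower tower).Φ₀.map f).hom := fun a b h => by
  rw [Φ₀_map_hom_eq, Φ₀_map_hom_eq] at h
  exact phiZeroPull_injective _ f.unop.hom.hom (hom_surjective_temperedInclusion f.unop)
    (ZTower.pow_left_injective γ _ (e_lvl_pos f) h)

/-- **The transitions of `Φ₀` at the tower reflect divisibility.** [cite: MochizukiEtTh2009, Def 3.3 (iii) p.74] -/
theorem Φ₀_map_reflects_dvd {Y Y' : (ConnectedPart (BTemp Grp))ᵒᵖ} (f : Y ⟶ Y') (a b : (DivisorMonoids.ofTower tower).Φ₀.obj Y)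
    (h : ((DivisorMonoids.ofTower tower).Φ₀.map f).hom a ∣ ((DivisorMonoids.ofTower tower).Φ₀.map f).hom b) : a ∣ b := by
  rw [Φ₀_map_hom_eq, Φ₀_map_hom_eq] at h
  have h' : (ZTower.action γ).phiZeroPull f.unop.hom.hom a ∣ (ZTower.action γ).phiZeroPull f.unop.hom.hom b :=
    (ZTower.pow_dvd_pow_iff γ (gset Y'.unop) (e_lvl_pos f)).1 h
  exact phiZeroPull_reflects_dvd _ f.unop.hom.hom (hom_surjective_temperedInclusion f.unop) a b h'

/-- **Diagonal base data of the Kummer–Tate tower over the WHOLE base `B^temp(Grp)⁰`** (identity base functor): coordinates =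
multiplicities `ZTower.coord γ (s, n)` at the covering's own level, diagonal = the reduced special fibre `ZTower.diag γ`,
`Φ₀^cnst(Y) = ⟨[diag]⟩`. [cite: MochizukiEtTh2009, Def 3.6 p.77] -/
def diagonalBase : TemperedFrobenioid.DiagonalBase (DivisorMonoids.ofTower tower) (ConnectedPart (BTemp Grp)) where
  F := 𝟭 _
  I A := (gset A).V × ℤ
  i₀ A := ((isConnectedGSet_gset A).1.some, 0)
  κ A i := ZTower.coord γ (gset A) i.1 i.2
  d A := ZTower.diag γ (gset A)
  κ_d A i := ZTower.coord_diag γ (gset A) i.1 i.2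
  eq_pow_of_κ_eq A _ _ h := ZTower.eq_diag_pow_of_coord_eq γ (gset A) fun s n => h (s, n)
  div₀_mem_zpowers A _ hb := ZTower.divZeroHom_mem_zpowers_of_mem_fZero γ (isConnectedGSet_gset A) hb
  exists_div₀_eq A := ⟨ZTower.cnstFn γ (gset A) 1, ZTower.cnstFn_mem_fZero γ _ 1, ZTower.divZeroHom_cnstFn_one γ _⟩
  hΦinj f := Φ₀_map_injective f.op
  hΦrefl f a b h := Φ₀_map_reflects_dvd f.op a b h

variable (R S : ((ConnectedPart (BTemp Grp))ᵒᵖ ⥤ CommMonCat.{0}) → Prop)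

/-- **The diagonal-base tempered Frobenioid of the Kummer–Tate tower over the whole of `B^temp(Grp)⁰`** (this seat's engine
`TemperedFrobenioid.ofDiagonalBase`; monoid type `ℤ`, weak vocabulary of record, every Def. 3.6 (ii) clause proved).
[cite: MochizukiEtTh2009, Def 3.6 p.77] -/
def diagTemperedFrobenioid :
    TemperedFrobenioid (RealifiedDivisorMonoids.ofRlfZWeak (DivisorMonoids.ofTower tower) hpf) (ConnectedPart (BTemp Grp))
      (treeCatVocab (ConnectedPart (BTemp Grp)) R S) :=
  TemperedFrobenioid.ofDiagonalBase hpf diagonalBase QuasiTemperoid.BTempConnected.connectedPart_isConnected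
    QuasiTemperoid.BTempConnected.connectedPart_isTotallyEpimorphic QuasiTemperoid.BTempConnected.connectedPart_isOfFSMType R S

/-- Its base functor is the identity of `B^temp(Grp)⁰`. [cite: MochizukiEtTh2009, Def 3.6 p.77] -/
theorem diagTemperedFrobenioid_base : (diagTemperedFrobenioid R S).base = 𝟭 _ := rfl

/-- The base functor is full. [cite: MochizukiEtTh2009, Def 4.1 p.86] -/
theorem diagTemperedFrobenioid_base_full : (diagTemperedFrobenioid R S).base.Full := by
  rw [diagTemperedFrobenioid_base]; infer_instance

/-- The base functor is essentially surjective. [cite: MochizukiEtTh2009, Def 4.1 p.86] -/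
theorem diagTemperedFrobenioid_base_essSurj : (diagTemperedFrobenioid R S).base.EssSurj := by
  rw [diagTemperedFrobenioid_base]; infer_instance

/-- **Def. 3.6 (ii)(a) with content**: `Φ^{bs-fld}(Y) = ι(⟨diag⟩^pf)`. [cite: MochizukiEtTh2009, Def 3.6 p.77] -/
theorem diagTemperedFrobenioid_bsFld_carrier (A : (ConnectedPart (BTemp Grp))ᵒᵖ) :
    (diagTemperedFrobenioid R S).bsFld.carrier A = diagonalBase.diagImage hpf A :=
  TemperedFrobenioid.ofDiagonalBase_bsFld_carrier hpf diagonalBase _ _ _ R S A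

/-- **It IS a Frobenioid** ([FrdI] Thm. 5.2 (ii); `hB₀inj` = abc-iut-L2-t3's injectivity of the `B₀`-transitions of `ofTower`).
[cite: MochizukiFrdI2008, Thm. 5.2 (ii) p.100] -/
theorem isFrobenioid_diagTemperedFrobenioid
    (hB₀inj : ∀ {Y Y' : (ConnectedPart (BTemp Grp))ᵒᵖ} (g : Y ⟶ Y'), Injective ((DivisorMonoids.ofTower tower).B₀.map g).hom) :
    PreFrobenioid.IsFrobenioid (diagTemperedFrobenioid R S).toElem :=
  TemperedFrobenioid.isFrobenioid_ofDiagonalBase hpf diagonalBase _ _ _ R S hB₀inj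

/-- `Φ(Y)` is perfect (the `hP` slot of the §4 model). [cite: MochizukiEtTh2009, Def 4.1 p.86] -/
theorem diag_hP (A : (ConnectedPart (BTemp Grp))ᵒᵖ) : IsPerfect ((diagTemperedFrobenioid R S).Φ.carrier A) :=
  TemperedFrobenioid.ofDiagonalBase_isPerfect hpf diagonalBase _ _ _ R S A

/-! ### `Φ^{bs-fld}` is PROPER at the covering `Grp/Δ₀ ≅ ℤ_γ` -/

/-- The covering `Grp/Δ₀` (`Δ₀ = ker γ`-type closure at level `0`): a `ℤ_γ`-torsor on which `Φ₀ = ∏_ℤ ℤ_{≥0}`.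
[cite: MochizukiEtTh2009, Def 3.3 (iii) p.73] -/
abbrev quotZero : ConnectedPart (BTemp Grp) := quotCover (closure 0) isOpen_closure_zero 0 le_rfl

/-- Over `Grp/Δ₀` the component `F_1` over the base point is NOT in the orbit of `F_0` (stabiliser `Δ₀` has `γ = 0`).
[cite: MochizukiEtTh2009, Rmk 3.3.1 p.73] -/
theorem not_inRay_quotZero_one :
    ¬ ZTower.InRay γ (gset quotZero) (((1 : Grp) : Grp ⧸ closure 0)) (((1 : Grp) : Grp ⧸ closure 0)) 1 := by
  rintro ⟨h, hs, hγ⟩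
  have hmem : h ∈ closure 0 := by
    have hs' : ((h * 1 : Grp) : Grp ⧸ closure 0) = ((1 : Grp) : Grp ⧸ closure 0) := hs
    rw [mul_one] at hs'
    have := QuotientGroup.eq.mp hs'
    rw [mul_one] at this
    exact inv_mem_iff.mp this
  have h1 : γ h = 1 := hmem.1
  rw [h1] at hγ
  exact one_ne_zero (ofAdd_eq_one.mp hγ.symm)

/-- **`Φ^{bs-fld} ⊊ Φ` at `Grp/Δ₀`**: the ray of `(s₀, F_0)` (a single component of the chain) lies in `Φ` but not in
`ι(⟨diag⟩^pf) = Φ^{bs-fld}`. [cite: MochizukiEtTh2009, Def 3.6 p.77] -/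
theorem exists_mem_Φ_not_mem_bsFld_quotZero :
    ∃ x ∈ (diagTemperedFrobenioid R S).Φ.carrier (op quotZero), x ∉ (diagTemperedFrobenioid R S).bsFld.carrier (op quotZero) := by
  have hM := hpf (op quotZero)
  refine ⟨hM.weak.toRealification (Perfection.of _ (ZTower.ray γ (gset quotZero) ((1 : Grp) : Grp ⧸ closure 0))), ⟨_, rfl⟩, ?_⟩
  rw [diagTemperedFrobenioid_bsFld_carrier]
  rintro ⟨b, hb⟩
  obtain ⟨⟨c, n⟩, rfl⟩ := Perfection.mk_surjective b
  have h1 : Perfection.mk (ZTower.diag γ (gset quotZero) ^ Multiplicative.toAdd c) n =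
      Perfection.mk (ZTower.ray γ (gset quotZero) ((1 : Grp) : Grp ⧸ closure 0)) 1 :=
    PfImageWeak.toRealification_injective hM.weak hb
  obtain ⟨N, hN⟩ := Perfection.mk_eq_mk_iff.mp h1
  rw [← pow_mul, PNat.one_coe, mul_one] at hN
  exact ZTower.ray_pow_ne_diag_pow γ (gset quotZero) _ not_inRay_quotZero_one (Nat.mul_ne_zero N.ne_zero n.ne_zero) _ hN.symm

/-! ### R566 (2): the A10 `BaseRootLaw` and condition (d) at THIS tempered Frobenioid, with NO E2 hypothesis -/

/-- **A10 `BaseRootLaw ⊤` for the diagonal-base tempered Frobenioid of the Kummer–Tate tower — NO `RootLaw` hypothesis** (abc-iut-w6-d058's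
`baseRootLaw_top_of_full_essSurj`: the base `𝟭` is full and essentially surjective; `TateTowerKummer.rootLaw` is a theorem).
[cite: MochizukiEtTh2009, Prop 4.2 (iii) p.89] -/
theorem diag_baseRootLaw_top : (diagTemperedFrobenioid R S).BaseRootLaw fun _ => True :=
  haveI := diagTemperedFrobenioid_base_full R S
  haveI := diagTemperedFrobenioid_base_essSurj R S
  baseRootLaw_top_of_full_essSurj (diagTemperedFrobenioid R S)

universe uD

/-- **Condition (d) of the canonical §4 model (`IG := ⊤`) over the diagonal-base tempered Frobenioid of the Kummer–Tate tower — NO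
`RootLaw` hypothesis** (abc-iut-w6-d058's `condD_mkOfModelCanonical_of_full_essSurj`; the standing §4-model binders `gS`, `NH`, `A₀`,
`hΦd`, `hTF` remain, `hP` is DISCHARGED by `diag_hP`). [cite: MochizukiEtTh2009, Def 4.1 (i) p.86] -/
theorem diag_condD_mkOfModelCanonical {K : Type 1} [Field K] (X : SemiGraphs.TemperedArithmeticGroup.{1} K)
    (gS : ∀ A : ConnectedPart (BTemp Grp), True → (X.Pi →* Aut A))
    (gSs : ∀ (A : ConnectedPart (BTemp Grp)) (h : True), Function.Surjective (gS A h))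
    (NH : Subgroup (Field.absoluteGaloisGroup K) → (diagTemperedFrobenioid R S).category → ℕ+ → Prop)
    (A₀ : (diagTemperedFrobenioid R S).category) (hA₀ : PreFrobenioid.IsFrobeniusTrivial (diagTemperedFrobenioid R S).toElem A₀)
    (hΦd : Objectwise (fun M _ => IsDivisorial M) (diagTemperedFrobenioid R S).divisorMonoid)
    (hTF : ∀ (A : ConnectedPart (BTemp Grp)) (N : ℕ), 0 < N →
      Function.Injective fun x : Algebra.GrothendieckGroup
        ((RealifiedDivisorMonoids.ofRlfZWeak (DivisorMonoids.ofTower tower) hpf).ΦR.obj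
          (op ((diagTemperedFrobenioid R S).base.obj A))) => x ^ N)
    (A : (BiKummerSetting.mkOfModelCanonical X (diagTemperedFrobenioid R S) rfl (diag_hP R S) (fun _ => True) gS gSs NH A₀ hA₀
      trivial).C)
    (f : (BiKummerSetting.mkOfModelCanonical X (diagTemperedFrobenioid R S) rfl (diag_hP R S) (fun _ => True) gS gSs NH A₀ hA₀
      trivial).biratUnits A) :
    BiKummerSetting.FractionPair.CondD (f := f) (fun {_} φ x => (diagTemperedFrobenioid R S).pullFracModel φ x) :=
  haveI := diagTemperedFrobenioid_base_full R S
  haveI := diagTemperedFrobenioid_base_essSurj R S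
  condD_mkOfModelCanonical_of_full_essSurj (diagTemperedFrobenioid R S) X (diag_hP R S) gS gSs NH A₀ hA₀ hΦd hTF A f

end TateTowerKummer

end Literature.AnabelianGeometry.EtaleTheta

end
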